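import Summits.Langlands.Langlands.Theorems.IrreducibilityBySelfDualityEssSelfDualIrreducibleCM
import HarnessLib

/-!
# `GaloisRepOfRegularAlgebraic` (item stmt-Langlands-10785) — the route's irreducibility step with
# ALMOST-EVERYWHERE compatible `ρ₁`, `ψ`

Helper file (`--supports stmt-Langlands-10785`).  The crux
`Summit.Langlands.Langlands.Theses.IrreducibilityBySelfDuality.GaloisRepOfRegularAlgebraic` (lang.S27
verbatim) asks for compatibility at EVERY unramified `v ∤ ℓ` (Varma 2024), but the only place the route
consumes it — `EssSelfDualIrreducibleCM.isIrreducible_of_compatible` via `trace_identity` and the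
dihedral exclusion — reads the Galois representations `ρ₁ = r(σ)`, `ψ = r(ν)` under cofinite filters.
This file re-proves those two theorems of item stmt-Langlands-13618 with the compatibility hypotheses on
`ρ₁`, `ψ` weakened from "every unramified `v ∤ ℓ`" to "almost every `v`" (`trace_identity_ae`,
`isIrreducible_of_compatible_ae`); the proofs are those of the tree with the two hypotheses joined to the
cofinite set of good places.  The companion file `…GaloisRepOfRegularAlgebraicGL2CMSuffices` draws the
plan-level consequence (the route needs lang.S27 only for `GL₂` over CM fields, almost everywhere,
hence from HLTT Thm. A (existence) alone, without Varma).

References: G. Böckle, C.-Y. Hui (2025), §3.2; D. Ramakrishnan (2014), Thm. A; P. Deligne,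
J.-P. Serre (1974), Lemme 3.2 (Chebotarev + Brauer–Nesbitt).
-/

noncomputable section

set_option linter.dupNamespace false -- project-wide option (lakefile weak.linter.dupNamespace); `Summit.Langlands.Langlands` is the mandated namespace (D-0017)

open scoped NumberField Classical
open Matrix Polynomial Filter IsDedekindDomain Field
open Literature.NumberTheory.Automorphic Literature.NumberTheory.GaloisRepresentations
open Summit.Langlands.Langlands.Theorems.EssSelfDualIrreducibleCM

namespace Summit.Langlands.Langlands.Theorems.GaloisRepOfRegularAlgebraic

/-! ### The character identity with almost-everywhere compatible `ρ₁`, `ψ` -/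

/-- **`EssSelfDualIrreducibleCM.trace_identity` with a.e. hypotheses.**  As `trace_identity`
(`tr r(g) · χ_cyc(g) ψ(g)⁻¹ + 1 = tr ρ₁(g) · tr ρ₁(g⁻¹)` on all of `Γ_K`), but `ρ₁` and `ψ` are only
assumed unramified and Satake–Frobenius compatible with `σ`, `ν` at ALMOST EVERY place (instead of at
every unramified `v ∤ ℓ`): the proof is unchanged — the two compatibilities join the cofinite set of
good places, good Frobenii are dense (Chebotarev, `absoluteGaloisGroup.frobenius_dense` with the proved
`chebotarev_artinRep_holds`) and both sides are continuous. [folklore] -/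
theorem trace_identity_ae {K : Type} [Field K] [NumberField K] {ℓ : ℕ} [Fact ℓ.Prime]
    (ι : PadicAlgCl ℓ ≃+* ℂ)
    {h1 : isCompact_glFiniteIntegralLevel 1 K} {hcpt₂ : isCompact_glFiniteIntegralLevel 2 K}
    {hcpt : isCompact_glFiniteIntegralLevel 3 K}
    (π : CuspidalAutomorphicRepData 3 K hcpt) (σ : CuspidalAutomorphicRepData 2 K hcpt₂)
    (ν : CuspidalAutomorphicRepData 1 K h1)
    (hAd : ∀ᶠ v : HeightOneSpectrum (𝓞 K) in cofinite, ∀ α β : Multiset ℂ, π.1.HasSatakeParamAt v α →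
      σ.1.HasSatakeParamAt v β → ∃ d : ℂ, ν.1.HasSatakeParamAt v {d} ∧
        α = (((β ×ˢ β).map (fun p : ℂ × ℂ => p.1 * p.2⁻¹)).erase 1).map (fun c => d * c))
    (ρ₁ : FramedGaloisRep K (PadicAlgCl ℓ) 2)
    (hρ₁ : ∀ᶠ v : HeightOneSpectrum (𝓞 K) in cofinite, ∀ β : Multiset ℂ, σ.1.HasSatakeParamAt v β →
      ρ₁.IsUnramifiedAt v ∧ ρ₁.HasFrobCharpolyAt v (arithFrobPolyOfSatake ι v.residueCard 2 β))
    (ψ : FramedGaloisRep K (PadicAlgCl ℓ) 1)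
    (hψ : ∀ᶠ v : HeightOneSpectrum (𝓞 K) in cofinite, ∀ γ : Multiset ℂ, ν.1.HasSatakeParamAt v γ →
      ψ.IsUnramifiedAt v ∧ ψ.HasFrobCharpolyAt v (arithFrobPolyOfSatake ι v.residueCard 1 γ))
    (cyc : FramedGaloisRep K (PadicAlgCl ℓ) 1)
    (hcyc : ∀ g : absoluteGaloisGroup K,
      ((cyc g : GL (Fin 1) (PadicAlgCl ℓ)) : Matrix (Fin 1) (Fin 1) (PadicAlgCl ℓ)) 0 0 =
        algebraMap ℚ_[ℓ] (PadicAlgCl ℓ) (((GaloisRep.cyclotomicCharacter K ℓ g : ℤ_[ℓ]ˣ) : ℤ_[ℓ]) : ℚ_[ℓ]))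
    (r : FramedGaloisRep K (PadicAlgCl ℓ) 3)
    (hr : ∀ᶠ v : HeightOneSpectrum (𝓞 K) in cofinite, ∀ α : Multiset ℂ, π.1.HasSatakeParamAt v α →
      r.IsUnramifiedAt v ∧ r.HasFrobCharpolyAt v (arithFrobPolyOfSatake ι v.residueCard 3 α))
    (g : absoluteGaloisGroup K) :
    FramedRep.trace r g * ((FramedRep.det cyc * (FramedRep.det ψ)⁻¹) g : PadicAlgCl ℓ) + 1 =
      FramedRep.trace ρ₁ g * FramedRep.trace ρ₁ g⁻¹ := by
  classical
  set cχ : absoluteGaloisGroup K →ₜ* (PadicAlgCl ℓ)ˣ := FramedRep.det cyc * (FramedRep.det ψ)⁻¹ with hcχ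
  have hcχg : ∀ g, (cχ g : PadicAlgCl ℓ) =
      ((cyc g : GL (Fin 1) (PadicAlgCl ℓ)) : Matrix (Fin 1) (Fin 1) (PadicAlgCl ℓ)) 0 0 *
        (((ψ g : GL (Fin 1) (PadicAlgCl ℓ)) : Matrix (Fin 1) (Fin 1) (PadicAlgCl ℓ)) 0 0)⁻¹ := fun g => by
    rw [hcχ, ContinuousMonoidHom.mul_apply, Units.val_mul]
    change (FramedRep.det cyc g : PadicAlgCl ℓ) * (((FramedRep.det ψ g)⁻¹ : (PadicAlgCl ℓ)ˣ) : PadicAlgCl ℓ) = _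
    rw [Units.val_inv_eq_inv_val, FramedRep.det_apply, FramedRep.det_apply,
      Matrix.GeneralLinearGroup.val_det_apply, Matrix.GeneralLinearGroup.val_det_apply, Matrix.det_fin_one,
      Matrix.det_fin_one]
  -- the good places
  have hπc : ∀ᶠ v : HeightOneSpectrum (𝓞 K) in cofinite, π.1.IsUnramifiedAt v :=
    AutomorphicRepData.hasSatakeParamAt_cofinite_holds π.1
  have hσc : ∀ᶠ v : HeightOneSpectrum (𝓞 K) in cofinite, σ.1.IsUnramifiedAt v :=
    AutomorphicRepData.hasSatakeParamAt_cofinite_holds σ.1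
  set good : HeightOneSpectrum (𝓞 K) → Prop := fun v =>
    ((ℓ : ℕ) : 𝓞 K) ∉ v.asIdeal ∧ π.1.IsUnramifiedAt v ∧ σ.1.IsUnramifiedAt v ∧
      (∀ α : Multiset ℂ, π.1.HasSatakeParamAt v α →
        r.IsUnramifiedAt v ∧ r.HasFrobCharpolyAt v (arithFrobPolyOfSatake ι v.residueCard 3 α)) ∧
      (∀ α β : Multiset ℂ, π.1.HasSatakeParamAt v α → σ.1.HasSatakeParamAt v β → ∃ d : ℂ,
        ν.1.HasSatakeParamAt v {d} ∧
          α = (((β ×ˢ β).map (fun p : ℂ × ℂ => p.1 * p.2⁻¹)).erase 1).map (fun c => d * c)) ∧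
      (∀ β : Multiset ℂ, σ.1.HasSatakeParamAt v β →
        ρ₁.IsUnramifiedAt v ∧ ρ₁.HasFrobCharpolyAt v (arithFrobPolyOfSatake ι v.residueCard 2 β)) ∧
      (∀ γ : Multiset ℂ, ν.1.HasSatakeParamAt v γ →
        ψ.IsUnramifiedAt v ∧ ψ.HasFrobCharpolyAt v (arithFrobPolyOfSatake ι v.residueCard 1 γ))
    with hgood_def
  have hgood : ∀ᶠ v in cofinite, good v := by
    filter_upwards [FramedGaloisRep.eventually_natCast_not_mem K ℓ, hπc, hσc, hr, hAd, hρ₁, hψ]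
      with v h1' h2' h3' h4' h5' h6' h7'
    exact ⟨h1', h2', h3', h4', h5', h6', h7'⟩
  set S : Set (HeightOneSpectrum (𝓞 K)) := {v | ¬ good v} with hS
  have hSfin : S.Finite := Filter.eventually_cofinite.1 hgood
  -- both sides are continuous functions of `g`
  set F₁ : absoluteGaloisGroup K → PadicAlgCl ℓ := fun g =>
    FramedRep.trace r g * (cχ g : PadicAlgCl ℓ) + 1 with hF₁
  set F₂ : absoluteGaloisGroup K → PadicAlgCl ℓ := fun g =>
    FramedRep.trace ρ₁ g * FramedRep.trace ρ₁ g⁻¹ with hF₂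
  have hF₁c : Continuous F₁ :=
    ((FramedRep.continuous_trace r).mul (Units.continuous_val.comp (map_continuous cχ))).add
      continuous_const
  have hF₂c : Continuous F₂ :=
    (FramedRep.continuous_trace ρ₁).mul ((FramedRep.continuous_trace ρ₁).comp continuous_inv)
  -- the identity holds on Frobenii over good places
  have hfrob : {g : absoluteGaloisGroup K | ∃ v ∉ S, ∃ 𝔓 ∈ v.primesAbove, IsArithFrobAt (𝓞 K) g 𝔓} ⊆
      {g | F₁ g = F₂ g} := by
    rintro g ⟨v, hv, 𝔓, h𝔓, hg⟩
    simp only [hS, Set.mem_setOf_eq, not_not] at hv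
    obtain ⟨hℓ, ⟨α, hα⟩, ⟨β, hβ⟩, hrv, hAdv, hρ₁v, hψv⟩ := hv
    obtain ⟨d, hνd, hαeq⟩ := hAdv α β hα hβ
    obtain ⟨x, y, rfl⟩ := Multiset.card_eq_two.mp hβ.card_eq
    have hx : x ≠ 0 := hasSatakeParamAt_ne_zero_holds hβ x (by simp)
    have hy : y ≠ 0 := hasSatakeParamAt_ne_zero_holds hβ y (by simp)
    have hd : d ≠ 0 := hasSatakeParamAt_ne_zero_holds hνd d (by simp)
    have hq : v.residueCard ≠ 0 := by
      have := HeightOneSpectrum.one_lt_residueCard v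
      omega
    have h₃ : FramedRep.charpoly r g =
        arithFrobPolyOfSatake ι v.residueCard 3 {d * (x * y⁻¹), d * (y * x⁻¹), d} := by
      rw [← adParams_pair hx hy d, ← hαeq]
      exact (hrv α hα).2 𝔓 h𝔓 g hg
    have h₂ : FramedRep.charpoly ρ₁ g = arithFrobPolyOfSatake ι v.residueCard 2 {x, y} :=
      (hρ₁v _ hβ).2 𝔓 h𝔓 g hg
    have hψg : (((ψ g : GL (Fin 1) (PadicAlgCl ℓ)) : Matrix (Fin 1) (Fin 1) (PadicAlgCl ℓ)) 0 0) =
        ι.symm d⁻¹ := by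
      have h := (hψv {d} hνd).2
      rw [arithFrobPolyOfSatake_one, Multiset.map_singleton, Multiset.prod_singleton] at h
      exact (FramedGaloisRep.hasFrobCharpolyAt_iff_of_rank_one ψ v _).mp h 𝔓 h𝔓 g hg
    have hcycg : (((cyc g : GL (Fin 1) (PadicAlgCl ℓ)) : Matrix (Fin 1) (Fin 1) (PadicAlgCl ℓ)) 0 0) =
        (v.residueCard : PadicAlgCl ℓ) :=
      (FramedGaloisRep.hasFrobCharpolyAt_iff_of_rank_one cyc v _).mp
        (FramedGaloisRep.hasFrobCharpolyAt_natCast_of_cyclotomic cyc hcyc hℓ) 𝔓 h𝔓 g hg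
    show F₁ g = F₂ g
    simp only [hF₁, hF₂, hcχg, hψg, hcycg]
    unfold FramedRep.charpoly at h₃ h₂
    unfold FramedRep.trace
    rw [map_inv]
    exact trace_identity_of_charpoly_eq ι hq hx hy hd h₃ h₂
  -- density of good Frobenii and closedness of the coincidence set
  have hclosed : IsClosed {g : absoluteGaloisGroup K | F₁ g = F₂ g} := isClosed_eq hF₁c hF₂c
  have hmem : g ∈ closure {g : absoluteGaloisGroup K | ∃ v ∉ S, ∃ 𝔓 ∈ v.primesAbove,
      IsArithFrobAt (𝓞 K) g 𝔓} := by
    rw [(absoluteGaloisGroup.frobenius_dense chebotarev_artinRep_holds K S hSfin).closure_eq]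
    exact Set.mem_univ g
  exact hclosed.closure_subset_iff.2 hfrob hmem

/-! ### Irreducibility with almost-everywhere compatible `ρ₁`, `ψ` -/

/-- **`EssSelfDualIrreducibleCM.isIrreducible_of_compatible` with a.e. hypotheses.**  `K` a number
field, `π` cuspidal on `GL₃`, `σ` cuspidal on `GL₂` with no a.e. Satake self-twist by any quadratic
sign, `ν` on `GL₁` with `t_{π,v} = d_v · Ad(t_{σ,v})` a.e., `ρ₁`, `ψ` `ℓ`-adic representations
compatible with `σ`, `ν` ALMOST EVERYWHERE (the only change), `r` semisimple of rank 3 compatible with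
`π` a.e. without three independent stable lines: then `r` is irreducible.  Same proof as the item-13618
theorem (twist by `χ_cyc ψ⁻¹`, `trace_identity_ae`, Brauer–Nesbitt, `Ad⁰ ρ₁`, Schur, the quadratic
field of an eigencharacter); the dihedral exclusion reads `ρ₁`'s compatibility under its cofinite
filter. (Böckle–Hui 2025 §3.2; Ramakrishnan 2014.) [folklore] -/
theorem isIrreducible_of_compatible_ae :
    ∀ {K : Type} [Field K] [NumberField K] {ℓ : ℕ} [Fact ℓ.Prime] (ι : PadicAlgCl ℓ ≃+* ℂ)
    {h1 : isCompact_glFiniteIntegralLevel 1 K} {hcpt₂ : isCompact_glFiniteIntegralLevel 2 K}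
    {hcpt : isCompact_glFiniteIntegralLevel 3 K}
    (π : CuspidalAutomorphicRepData 3 K hcpt) (σ : CuspidalAutomorphicRepData 2 K hcpt₂)
    (ν : CuspidalAutomorphicRepData 1 K h1)
    (hnd : ∀ (L : Type) [Field L] [NumberField L] [Algebra K L], Module.finrank K L = 2 →
      ¬ (∀ᶠ v : HeightOneSpectrum (𝓞 K) in cofinite, ∀ β : Multiset ℂ, σ.1.HasSatakeParamAt v β →
        β.map (fun b => (if ∃ w : HeightOneSpectrum (𝓞 L), w.asIdeal.under (𝓞 K) = v.asIdeal ∧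
          w.asIdeal.inertiaDeg (𝓞 K) = 1 then (1 : ℂ) else -1) * b) = β))
    (hAd : ∀ᶠ v : HeightOneSpectrum (𝓞 K) in cofinite, ∀ α β : Multiset ℂ, π.1.HasSatakeParamAt v α →
      σ.1.HasSatakeParamAt v β → ∃ d : ℂ, ν.1.HasSatakeParamAt v {d} ∧
        α = (((β ×ˢ β).map (fun p : ℂ × ℂ => p.1 * p.2⁻¹)).erase 1).map (fun c => d * c))
    (ρ₁ : FramedGaloisRep K (PadicAlgCl ℓ) 2)
    (hρ₁ : ∀ᶠ v : HeightOneSpectrum (𝓞 K) in cofinite, ∀ β : Multiset ℂ, σ.1.HasSatakeParamAt v β →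
      ρ₁.IsUnramifiedAt v ∧ ρ₁.HasFrobCharpolyAt v (arithFrobPolyOfSatake ι v.residueCard 2 β))
    (ψ : FramedGaloisRep K (PadicAlgCl ℓ) 1)
    (hψ : ∀ᶠ v : HeightOneSpectrum (𝓞 K) in cofinite, ∀ γ : Multiset ℂ, ν.1.HasSatakeParamAt v γ →
      ψ.IsUnramifiedAt v ∧ ψ.HasFrobCharpolyAt v (arithFrobPolyOfSatake ι v.residueCard 1 γ))
    (r : FramedGaloisRep K (PadicAlgCl ℓ) 3) (hrss : r.toGaloisRep.IsSemisimple)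
    (hr : ∀ᶠ v : HeightOneSpectrum (𝓞 K) in cofinite, ∀ α : Multiset ℂ, π.1.HasSatakeParamAt v α →
      r.IsUnramifiedAt v ∧ r.HasFrobCharpolyAt v (arithFrobPolyOfSatake ι v.residueCard 3 α))
    (h3 : ¬ (∃ x : Fin 3 → (Fin 3 → PadicAlgCl ℓ), LinearIndependent (PadicAlgCl ℓ) x ∧
      ∀ (i : Fin 3) (g : absoluteGaloisGroup K), ∃ c : PadicAlgCl ℓ, r.toGaloisRep g (x i) = c • x i)),
    r.toGaloisRep.IsIrreducible := by
  intro K _ _ ℓ _ ι h1 hcpt₂ hcpt π σ ν hnd hAd ρ₁ hρ₁ ψ hψ r hrss hr h3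
  classical
  obtain ⟨cyc, hcyc⟩ := FramedGaloisRep.exists_cyclotomic_padicAlgCl K ℓ
  set cχ : absoluteGaloisGroup K →ₜ* (PadicAlgCl ℓ)ˣ := FramedRep.det cyc * (FramedRep.det ψ)⁻¹ with hcχ
  have hkey : ∀ g, FramedRep.trace r g * (cχ g : PadicAlgCl ℓ) + 1 =
      FramedRep.trace ρ₁ g * FramedRep.trace ρ₁ g⁻¹ := fun g =>
    trace_identity_ae ι π σ ν hAd ρ₁ hρ₁ ψ hψ cyc hcyc r hr g
  -- the twist `r' = r ⊗ χ_cyc ψ⁻¹`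
  set r' : FramedGaloisRep K (PadicAlgCl ℓ) 3 := FramedRep.twist r cχ with hr'
  have htw : FramedRep.toRepresentation r' =
      Literature.RepresentationTheory.Semisimple.Representation.twist (FramedRep.toRepresentation r)
        cχ.toMonoidHom := toRepresentation_twist r cχ
  have hrss0 : (FramedRep.toRepresentation r).IsSemisimpleRepresentation := hrss
  haveI hr'ss : (FramedRep.toRepresentation r').IsSemisimpleRepresentation := by
    rw [htw]
    exact (Literature.RepresentationTheory.Semisimple.Representation.isSemisimpleRepresentation_twist_iff
      _ _).mpr hrss0
  have hchar' : ∀ g, (FramedRep.toRepresentation r').character g =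
      FramedRep.trace ρ₁ g * FramedRep.trace ρ₁ g⁻¹ - 1 := fun g => by
    rw [show (FramedRep.toRepresentation r').character g = FramedRep.trace r' g from
      FramedGaloisRep.character_toRepresentation r' g, hr', trace_twist, ← hkey g]
    ring
  -- it suffices to prove that `r'` is irreducible
  suffices hirr' : (FramedRep.toRepresentation r').IsIrreducible by
    rw [htw] at hirr'
    exact (Literature.RepresentationTheory.Semisimple.Representation.isIrreducible_twist_iff _ _).mp hirr'
  have h2 : (2 : PadicAlgCl ℓ) ≠ 0 := two_ne_zero
  by_cases hρ : (FramedRep.toRepresentation ρ₁).IsIrreducible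
  · /- Case `ρ₁` irreducible: `Ad⁰ ρ₁` is irreducible, and `r' ≅ Ad⁰ ρ₁`. -/
    have hρ' : Representation.IsIrreducible ((Representation.ofDistribMulAction (PadicAlgCl ℓ)
        (GL (Fin 2) (PadicAlgCl ℓ)) (Fin 2 → PadicAlgCl ℓ)).comp ρ₁.toMonoidHom) := hρ
    obtain ⟨Ad, φ, hφinj, hφtr, hAdφ, hAdchar⟩ := exists_adZero (k := PadicAlgCl ℓ) ρ₁.toMonoidHom
    have hAdirr : Ad.IsIrreducible := by
      by_contra hnot
      obtain ⟨T, χ, hT, hTtr, hconj⟩ := exists_eigenmatrix_of_not_isIrreducible h2 ρ₁.toMonoidHom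
        (Module.finrank_fin_fun (PadicAlgCl ℓ)) Ad φ hφinj hφtr hAdφ hnot
      have hdet : T.det ≠ 0 :=
        det_ne_zero_of_eigenmatrix ρ₁.toMonoidHom hρ' hT (χ := fun g => (χ g : PadicAlgCl ℓ)) hconj
      obtain ⟨g₀, hg₀⟩ := exists_ne_one_of_eigenmatrix_of_trace_eq_zero h2 ρ₁.toMonoidHom hρ' hT hTtr
        (χ := fun g => (χ g : PadicAlgCl ℓ)) hconj
      have hsq : ∀ g, (χ g : PadicAlgCl ℓ) ^ 2 = 1 := fun g =>
        sq_eq_one_of_eigenmatrix ρ₁.toMonoidHom hdet (χ := fun g => (χ g : PadicAlgCl ℓ)) hconj g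
      have hcp : ∀ g, ((χ g : PadicAlgCl ℓ) • ((ρ₁ g : GL (Fin 2) (PadicAlgCl ℓ)) :
          Matrix (Fin 2) (Fin 2) (PadicAlgCl ℓ))).charpoly =
            ((ρ₁ g : GL (Fin 2) (PadicAlgCl ℓ)) : Matrix (Fin 2) (Fin 2) (PadicAlgCl ℓ)).charpoly :=
        fun g => charpoly_smul_eq_of_eigenmatrix ρ₁.toMonoidHom hT hdet
          (χ := fun g => (χ g : PadicAlgCl ℓ)) hconj g
      -- `H = ker χ` is open of index `2`; the quadratic field it cuts out
      have hopen : IsOpen (χ.ker : Set (absoluteGaloisGroup K)) :=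
        isOpen_ker_of_eigenmatrix h2 ρ₁ hT χ hconj hsq
      have hg₀' : χ g₀ ≠ 1 := fun h => hg₀ (by simp only [h, Units.val_one])
      have hidx : χ.ker.index = 2 := index_ker_eq_two h2 χ hsq hg₀'
      obtain ⟨L, _, _, _, hL2, hdict⟩ := exists_quadratic_frob_mem_iff K χ.ker hopen hidx
      refine hnd L hL2 ?_
      filter_upwards [hdict, hρ₁] with v hv hρ₁v
      intro β hβ
      obtain ⟨𝔓, h𝔓⟩ := HeightOneSpectrum.primesAbove_nonempty v
      obtain ⟨Φ, hΦ⟩ := HeightOneSpectrum.exists_isArithFrobAt_of_mem_primesAbove_holds (v := v) h𝔓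
      have hcpΦ : FramedRep.charpoly ρ₁ Φ = arithFrobPolyOfSatake ι v.residueCard 2 β :=
        (hρ₁v β hβ).2 𝔓 h𝔓 Φ hΦ
      by_cases hΦ1 : Φ ∈ χ.ker
      · have hP : ∃ w : HeightOneSpectrum (𝓞 L), w.asIdeal.under (𝓞 K) = v.asIdeal ∧
            w.asIdeal.inertiaDeg (𝓞 K) = 1 := (hv 𝔓 h𝔓 Φ hΦ).mp hΦ1
        simp only [if_pos hP, one_mul, Multiset.map_id']
      · have hP : ¬ ∃ w : HeightOneSpectrum (𝓞 L), w.asIdeal.under (𝓞 K) = v.asIdeal ∧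
            w.asIdeal.inertiaDeg (𝓞 K) = 1 := fun h => hΦ1 ((hv 𝔓 h𝔓 Φ hΦ).mpr h)
        simp only [if_neg hP]
        have hχΦ : (χ Φ : PadicAlgCl ℓ) = -1 := by
          have : ((χ Φ : PadicAlgCl ℓ) - 1) * ((χ Φ : PadicAlgCl ℓ) + 1) = 0 := by
            linear_combination hsq Φ
          rcases mul_eq_zero.mp this with h0 | h0
          · exact absurd (Units.val_eq_one.mp (sub_eq_zero.mp h0)) hΦ1
          · exact eq_neg_of_add_eq_zero_left h0
        have hq : v.residueCard ≠ 0 := by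
          have := HeightOneSpectrum.one_lt_residueCard v
          omega
        unfold FramedRep.charpoly at hcpΦ
        refine map_neg_eq_of_charpoly_neg_eq ι hq hcpΦ ?_
        rw [Units.val_neg, Units.val_one, ← hχΦ]
        exact hcp Φ
    -- Brauer–Nesbitt: `Ad ≅ r'`
    haveI : Ad.IsIrreducible := hAdirr
    haveI : Ad.IsSemisimpleRepresentation := inferInstance
    have hch : Ad.character = (FramedRep.toRepresentation r').character := by
      funext g
      rw [hAdchar, hchar']
      unfold FramedRep.trace
      rw [map_inv]
      rfl
    obtain ⟨e⟩ := Literature.RepresentationTheory.Semisimple.Representation.nonempty_equiv_of_character_eq_of_isSemisimple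
      Ad (FramedRep.toRepresentation r') hch
    exact Literature.RepresentationTheory.Semisimple.Representation.isIrreducible_of_equiv e
  · /- Case `ρ₁` reducible: `χ_{r'} = 1 + μ + μ⁻¹`, three stable lines. -/
    exfalso
    obtain ⟨χ₁, χ₂, hχ⟩ := exists_characters_of_not_isIrreducible ρ₁.toMonoidHom hρ
    have htr : ∀ g, FramedRep.trace ρ₁ g = (χ₁ g : PadicAlgCl ℓ) + (χ₂ g : PadicAlgCl ℓ) := fun g => hχ g
    set μ : absoluteGaloisGroup K →* (PadicAlgCl ℓ)ˣ := χ₁ * χ₂⁻¹ with hμ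
    have hcharμ : ∀ g, (FramedRep.toRepresentation r').character g =
        1 + (μ g : PadicAlgCl ℓ) + ((μ g)⁻¹ : (PadicAlgCl ℓ)ˣ) := fun g => by
      rw [hchar', htr, htr g⁻¹, map_inv, map_inv, hμ, MonoidHom.mul_apply, MonoidHom.inv_apply]
      simp only [_root_.mul_inv_rev, inv_inv, Units.val_mul, Units.val_inv_eq_inv_val]
      have h₁ : (χ₁ g : PadicAlgCl ℓ) ≠ 0 := Units.ne_zero _
      have h₂ : (χ₂ g : PadicAlgCl ℓ) ≠ 0 := Units.ne_zero _
      field_simp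
      ring
    obtain ⟨x, hx, hlines⟩ := exists_three_eigenlines_of_character_eq (FramedRep.toRepresentation r') μ hcharμ
    apply h3
    refine ⟨x, hx, fun i g => ?_⟩
    obtain ⟨c, hc⟩ := hlines i g
    rw [FramedRep.toRepresentation_apply_apply, hr', FramedRep.coe_twist_apply, Matrix.smul_mulVec] at hc
    refine ⟨(cχ g : PadicAlgCl ℓ)⁻¹ * c, ?_⟩
    change ((r g : GL (Fin 3) (PadicAlgCl ℓ)) : Matrix (Fin 3) (Fin 3) (PadicAlgCl ℓ)) *ᵥ x i = _
    calc ((r g : GL (Fin 3) (PadicAlgCl ℓ)) : Matrix (Fin 3) (Fin 3) (PadicAlgCl ℓ)) *ᵥ x i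
        = (cχ g : PadicAlgCl ℓ)⁻¹ • ((cχ g : PadicAlgCl ℓ) •
            (((r g : GL (Fin 3) (PadicAlgCl ℓ)) : Matrix (Fin 3) (Fin 3) (PadicAlgCl ℓ)) *ᵥ x i)) := by
          rw [smul_smul, inv_mul_cancel₀ (Units.ne_zero _), one_smul]
      _ = ((cχ g : PadicAlgCl ℓ)⁻¹ * c) • x i := by rw [hc, smul_smul]


/-! ### The item `EssSelfDualIrreducibleCM` (stmt-Langlands-13618), structural form

The statement below is the TEXT of the route decl
`Summit.Langlands.Langlands.Theses.IrreducibilityBySelfDuality.EssSelfDualIrreducibleCM` with its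
by-name antecedent `RegularAdjointLiftCM` replaced by that decl's body (verbatim), so that this module
does not import the Theses file (the gate's `_holds` link imports the proving module into the Theses
file; cf. the 2026-08-15 cycle incident recorded on `IrreducibleGL3CM`).  It is definitionally equal to
the route decl (`example : EssSelfDualIrreducibleCM := EssSelfDualIrreducibleCM_proof` elaborates
against the Theses module). -/

end Summit.Langlands.Langlands.Theorems.GaloisRepOfRegularAlgebraic

end
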